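import Mathlib
import HarnessLib
import Summits.HubbardSuperconductivity.HubbardSuperconductivity.Theorems.KLProgrammeKLRegimeEnginePlainLineFromMomentumRepresentation
import Summits.HubbardSuperconductivity.HubbardSuperconductivity.Theorems.KLProgrammeKLRegimeEngineTowerImportP2PlainFromValuesWt

/-!
# Route `KLProgramme` — engine support (rows E-b2(4)/E-b3 of the (b) closing path, NORM side, brick (T7w)): the WEIGHTED PLAIN FOUR-LEG LINE FROM A
# MOMENTUM-SPACE REPRESENTATION — one call composing the dictionary (T5b)/(T7), the one-moment bump bound (T1w) and the weighted superposition bound (T2w)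

Cell gate-hubbard-kl, seat hubbard-kl-k3c2-p3 (g17).  Weighted twin of `plainFourLegLine_of_momentumRepresentation` (p707689): a producer who shows that the
degree-4 MOMENTUM kernel of a Grassmann element `𝒱` on the charge string `(+,+,−,−)` (spins `σ`) is a finite superposition of CONSERVING TRANSFER BUMPS plus a
remainder, `kernel ℂ 𝒱 4 ((k_i,σ_i),c_i) = Σ_{i∈S} a_i · κ·[k̄₀+k̄₁ = k̄₂+k̄₃]·G_i(−(k̄₀+k̄₁)) + ρ(k)`, with (T1w)-bump data on each `G_i` (rates `(s₀ⁱ, s₁ⁱ) ∈ (0,1]²`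
DOMINATING the weight's rates `(Λ_jβ/(2M), Λ_j)`, size `A_i`, support `≤ n₀(s₀ⁱ·2M)(s₁ⁱL)²`, time/axis THIRD differences) and weighted pinned sums of the remainder's
plane-wave transform `≤ r` at every pinned leg, gets for EVERY pinned leg `q` and pin `y`

  `ε³·Σ_{x : x q = y} klScaleWt_j(pos x)·‖W^{1}_4(𝒱)_{(σ,(+,+,−,−))}(x)‖ ≤ ε_x³·2(‖κ‖(2M·L²)²)·√(6561988608·n₀)·(2M·L²)·Σ_{i∈S} ‖a_i‖·A_i + r`

— the `S₄ j` cell / `s₄` import binder of the weighted assemblies for that label string ((T2w) `wplainFourLegLine_of_pairTransfer_superposition` quantifies all strings;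
other balanced charge strings via (T6)'s permuted dictionary, same pattern).

* **`wplainFourLegLine_of_momentumRepresentation`** — the statement above (the dictionary step `norm_planeWaveSum_le_pairTransfer_of_conserving` is (T7)'s, verbatim).
Everything is proved; no definitions; nothing is asserted about any engine object (the representation is the HYPOTHESIS `hker`).
References: BGM 2006 §2.1 (2.2)–(2.6), §2.3 (2.17), §2.8 (2.81) [cite: BenfattoGiulianiMastropietro2006]; Katznelson, Ch. I §6.3.
-/

noncomputable section

namespace Summit.HubbardSuperconductivity.HubbardSuperconductivity.Theorems.TorusFourierL2

set_option linter.dupNamespace false -- summit = problem name (single-conjunct summit), D-0017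

open Finset Complex Literature.Probability.LatticeModels Literature.MathematicalPhysics.QuantumLattice
open Literature.MathematicalPhysics.QuantumLattice.GrassmannAlgebra
open Summit.HubbardSuperconductivity.HubbardSuperconductivity.Theorems.KLRegimeSplit
open Summit.HubbardSuperconductivity.HubbardSuperconductivity.Theorems.KLProgrammeLegKernels
open scoped Real ComplexConjugate

variable {L M : ℕ} [NeZero L] [NeZero M]

/-- **WEIGHTED PLAIN FOUR-LEG LINE FROM A MOMENTUM-SPACE REPRESENTATION, EVERY PINNED LEG** (see the module docstring).
[cite: BenfattoGiulianiMastropietro2006, §2.3 (2.17), §2.8 (2.81)] -/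
theorem wplainFourLegLine_of_momentumRepresentation {ι : Type*} {β : ℝ} (hβ : 0 < β) (𝒱 : HubbardGrassmann L M) (σ : Fin 4 → Fin 2)
    (S : Finset ι) (a : ι → ℂ) (κ : ℂ) (G : ι → TorusSite 1 (2 * M) × TorusSite 2 L → ℂ) (ρ : (Fin 4 → FreqMomentum L M) → ℂ)
    (hker : ∀ k : Fin 4 → FreqMomentum L M,
      kernel ℂ 𝒱 4 (fun i => ((k i, σ i), (![0, 0, 1, 1] : Fin 4 → Fin 2) i)) =
        ∑ i ∈ S, a i * (κ * (if ((fun _ : Fin 1 => ((((k 0).1 : ℕ) : ZMod (2 * M)))), (k 0).2) + ((fun _ : Fin 1 => ((((k 1).1 : ℕ) : ZMod (2 * M)))), (k 1).2) = (((fun _ : Fin 1 => ((((k 2).1 : ℕ) : ZMod (2 * M)))), (k 2).2) : TorusSite 1 (2 * M) × TorusSite 2 L) + ((fun _ : Fin 1 => ((((k 3).1 : ℕ) : ZMod (2 * M)))), (k 3).2) then (fun Q => G i (-Q)) (((fun _ : Fin 1 => ((((k 0).1 : ℕ) : ZMod (2 * M)))), (k 0).2) + ((fun _ : Fin 1 =>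 ((((k 1).1 : ℕ) : ZMod (2 * M)))), (k 1).2)) else 0)) + ρ k)
    (s₀ s₁ A : ι → ℝ) (Ns : ι → ℕ) {n₀ r : ℝ} (hn₀ : 0 ≤ n₀)
    (hs₀ : ∀ i ∈ S, 0 < s₀ i) (hs₀1 : ∀ i ∈ S, s₀ i ≤ 1) (hs₁ : ∀ i ∈ S, 0 < s₁ i) (hs₁1 : ∀ i ∈ S, s₁ i ≤ 1)
    (hA : ∀ i ∈ S, 0 ≤ A i) (hNs : ∀ i ∈ S, (Ns i : ℝ) ≤ n₀ * (s₀ i * (2 * M : ℕ)) * (s₁ i * L) ^ 2)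
    (hsupp : ∀ i ∈ S, (univ.filter fun q => G i q ≠ 0).card ≤ Ns i) (hsup : ∀ i ∈ S, ∀ q, ‖G i q‖ ≤ A i)
    (h₀ : ∀ i ∈ S, ∀ q, ‖(fwdDiff ((fun _ : Fin 1 => (1 : ZMod (2 * M))), (0 : TorusSite 2 L)))^[3] (G i) q‖ ≤
      A i * (4 / (s₀ i * (2 * M : ℕ))) ^ 3)
    (h₁ : ∀ i ∈ S, ∀ q (j : Fin 2), ‖(fwdDiff ((0 : TorusSite 1 (2 * M)), (Pi.single j (1 : ZMod L) : TorusSite 2 L)))^[3] (G i) q‖ ≤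
      A i * (4 / (s₁ i * L)) ^ 3)
    (j : ℕ) (hts₀ : ∀ i ∈ S, klScale klE0 j * β / (2 * M) ≤ s₀ i) (hts₁ : ∀ i ∈ S, klScale klE0 j ≤ s₁ i)
    (hr : ∀ (q : Fin 4) (y : SpaceTimeIdx L M), imagTimeWeight β M ^ 3 *
      ∑ x ∈ univ.filter (fun x : Fin 4 → SpaceTimeIdx L M => x q = y),
        EngineV8.klScaleWt L M β j ((univ.image x).image (fun x : SpaceTimeIdx L M => (((((2 * (x.1 : ℕ) : ℕ)) : ZMod (2 * (2 * M)))), x.2))) *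
          ‖(fun (Ω : Fin 4 → SectorLeg 1) (x : Fin 4 → SpaceTimeIdx L M) =>
            ∑ k : Fin 4 → FreqMomentum L M, (∏ i, trivialMultiplier L M (Ω i).1.1 (k i) * hubbardPlaneWave L M β (Ω i).2 (k i) (x i)) * ρ k)
            (fun i : Fin 4 => ((((0 : Fin 1), σ i) : Fin 1 × Fin 2), (![0, 0, 1, 1] : Fin 4 → Fin 2) i)) x‖ ≤ r)
    (q : Fin 4) (y : SpaceTimeIdx L M) :
    imagTimeWeight β M ^ 3 *
        ∑ x ∈ univ.filter (fun x : Fin 4 → SpaceTimeIdx L M => x q = y),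
          EngineV8.klScaleWt L M β j ((univ.image x).image (fun x : SpaceTimeIdx L M => (((((2 * (x.1 : ℕ) : ℕ)) : ZMod (2 * (2 * M)))), x.2))) *
            ‖sectorisedKernel L M β (trivialMultiplier L M) 𝒱 4 (fun i : Fin 4 => ((((0 : Fin 1), σ i) : Fin 1 × Fin 2), (![0, 0, 1, 1] : Fin 4 → Fin 2) i)) x‖ ≤
      imagTimeWeight β M ^ 3 * (2 * (‖κ‖ * ((((2 * M : ℕ) : ℝ) * (L : ℝ) ^ 2) ^ 2)) * (Real.sqrt (6561988608 * n₀) * (((2 * M : ℕ) : ℝ) * (L : ℝ) ^ 2))) *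
        ∑ i ∈ S, ‖a i‖ * A i + r := by
  classical
  have hβ0 : β ≠ 0 := hβ.ne'
  -- the position-level pieces
  refine (EngineV8.wtPinnedSum_le_of_pairTransfer_superposition hβ.le S a (sectorisedKernel L M β (trivialMultiplier L M) 𝒱 4)
    (fun (Ω : Fin 4 → SectorLeg 1) (x : Fin 4 → SpaceTimeIdx L M) =>
      ∑ k : Fin 4 → FreqMomentum L M, (∏ i, trivialMultiplier L M (Ω i).1.1 (k i) * hubbardPlaneWave L M β (Ω i).2 (k i) (x i)) * ρ k)
    (fun (i : ι) (Ω : Fin 4 → SectorLeg 1) (x : Fin 4 → SpaceTimeIdx L M) =>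
      ∑ k : Fin 4 → FreqMomentum L M, (∏ j, trivialMultiplier L M (Ω j).1.1 (k j) * hubbardPlaneWave L M β (Ω j).2 (k j) (x j)) *
        (κ * (if ((fun _ : Fin 1 => ((((k 0).1 : ℕ) : ZMod (2 * M)))), (k 0).2) + ((fun _ : Fin 1 => ((((k 1).1 : ℕ) : ZMod (2 * M)))), (k 1).2) = (((fun _ : Fin 1 => ((((k 2).1 : ℕ) : ZMod (2 * M)))), (k 2).2) : TorusSite 1 (2 * M) × TorusSite 2 L) + ((fun _ : Fin 1 => ((((k 3).1 : ℕ) : ZMod (2 * M)))), (k 3).2) then (fun Q => G i (-Q)) (((fun _ : Fin 1 => ((((k 0).1 : ℕ) : ZMod (2 * M)))), (k 0).2) + ((fun _ : Fin 1 => ((((k 1).1 : ℕ) : ZMod (2 * M)))), (k 1).2)) else 0)))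
    (fun i : Fin 4 => ((((0 : Fin 1), σ i) : Fin 1 × Fin 2), (![0, 0, 1, 1] : Fin 4 → Fin 2) i)) (fun x => ?_) G (c := ‖κ‖ * ((((2 * M : ℕ) : ℝ) * (L : ℝ) ^ 2) ^ 2)) (by positivity) (fun i hi x => ?_)
    j s₀ s₁ A Ns hn₀ hs₀ hs₀1 hs₁ hs₁1 hts₀ hts₁ hA hNs hsupp hsup h₀ h₁ q y).trans (add_le_add le_rfl (hr q y))
  · -- `hW`: linearity of the plane-wave sum in the kernel
    rw [sectorisedKernel_def]
    simp_rw [hker, mul_add, sum_add_distrib]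
    congr 1
    simp_rw [mul_sum]
    rw [sum_comm]
    exact sum_congr rfl fun i _ => sum_congr rfl fun k _ => by ring
  · -- `hB`: the dictionary, symbol `Q ↦ G i (−(−Q)) = G i Q`
    refine (norm_planeWaveSum_le_pairTransfer_of_conserving hβ0 σ
      (fun k => κ * (if ((fun _ : Fin 1 => ((((k 0).1 : ℕ) : ZMod (2 * M)))), (k 0).2) + ((fun _ : Fin 1 => ((((k 1).1 : ℕ) : ZMod (2 * M)))), (k 1).2) = (((fun _ : Fin 1 => ((((k 2).1 : ℕ) : ZMod (2 * M)))), (k 2).2) : TorusSite 1 (2 * M) × TorusSite 2 L) + ((fun _ : Fin 1 => ((((k 3).1 : ℕ) : ZMod (2 * M)))), (k 3).2) then (fun Q => G i (-Q)) (((fun _ : Fin 1 => ((((k 0).1 : ℕ) : ZMod (2 * M)))), (k 0).2) + ((fun _ : Fin 1 => ((((k 1).1 : ℕ) : ZMod (2 * M)))), (k 1).2)) else 0)) κ (fun Q => G i (-Q)) (fun k => rfl) x).trans (le_of_eq ?_)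
    first
      | rfl
      | simp only [neg_neg]

end Summit.HubbardSuperconductivity.HubbardSuperconductivity.Theorems.TorusFourierL2

end
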